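import Mathlib.LinearAlgebra.Matrix.Adjugate
import Mathlib.LinearAlgebra.Matrix.Block
import Mathlib.LinearAlgebra.Matrix.MvPolynomial

/-!
# The DESNANOT–JACOBI identity (Dodgson condensation) for the last two rows and columns

For a square matrix `A` of size `n + 2` over a commutative ring, with `a = Fin.last (n+1)`, `b = (Fin.last n).castSucc` the last two indices and
the interior kept by `Fin.castSucc ∘ Fin.castSucc : Fin n → Fin (n+2)`:
★ `adjugate_lastTwo_minor`: `adj A a a · adj A b b − adj A a b · adj A b a = det A · det A[interior]` (JACOBI's theorem, 2 × 2 case), and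
★★ `desnanot_jacobi`: `det A · det A[interior] = det A_a^a · det A_b^b − det A_a^b · det A_b^a` (`A_r^c` = delete row `r` and column `c`, via `Fin.succAbove`).
PROOF (classical): `X := 1` with columns `a, b` replaced by those of `adj A`; then `A·X` is `A` with columns `a, b` replaced by `det A·e_a`, `det A·e_b`
(✓ `Matrix.mul_adjugate`); both `X` and `A·X` are block-triangular for the partition {a,b} ⊔ interior (✓ `Matrix.twoBlockTriangular_det('`), so
`det A · (adj aa·adj bb − adj ab·adj ba) = det A² · det A[interior]`; cancel `det A` in the GENERIC matrix ring `MvPolynomial (Fin (n+2) × Fin (n+2)) ℤ`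
(a domain, ✓ `Matrix.det_mvPolynomialX_ne_zero` — the pattern of ✓ `Matrix.det_adjugate`) and specialise by `MvPolynomial.aeval`; finally
✓ `Matrix.adjugate_fin_succ_eq_det_submatrix` turns adjugate entries into signed minors.  Mathlib (this tree's snapshot) has no Desnanot–Jacobi /
Dodgson / Jacobi-minor theorem (`rg` over `.lake/packages/mathlib`: none).
PURPOSE: library ENGINE for the Wronskian–Sylvester identity `W(W(f⃗,g),W(f⃗,h)) = W(f⃗)·W(f⃗,g,h)` (next file `…WronskianSylvester`), wanted by TWO clients on the SIDE
ladder «table-rank-ladder» of crux `stmt-ValiantsHypothesis-5906` (`TwoProducts`): the KPT15-type Wronskian ladder T1-E′ (val-port-1 g5) and the OLM column route (K∞)/(TW-count)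
(val-port-4 g5, crit-8 g5 #85).  HONEST LABEL: pure linear algebra; nothing here is about 5906 / `PlanarCellBound` / `ResidualLawV25`; VP ≠ VNP is NOT proved here or anywhere in
this tree.  `--supports stmt-ValiantsHypothesis-5906 --as helper`.  No instances, no notation, no named facts.
[cite: C. L. Dodgson, Condensation of determinants, Proc. Roy. Soc. London 15 (1866) 150–155; D. M. Bressoud, Proofs and Confirmations, CUP 1999, §3.5] [folklore]
-/

set_option linter.dupNamespace false

namespace Summit.ValiantsHypothesis.ValiantsHypothesis.Theorems.TwoProducts.DesnanotJacobi

open Matrix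

variable {R : Type*} [CommRing R] {n : ℕ}

/-! ### §1 The two special indices and the interior -/

/-- `a = Fin.last (n+1)` and `b = (Fin.last n).castSucc` are distinct. [folklore] -/
theorem last_ne_castSucc_last : (Fin.last (n + 1) : Fin (n + 2)) ≠ (Fin.last n).castSucc := by
  intro h
  have := congrArg Fin.val h
  simp at this

/-- The PAIR predicate `j = a ∨ j = b` in numeric form: `n ≤ j`. [folklore] -/
theorem pair_iff (j : Fin (n + 2)) : (j = Fin.last (n + 1) ∨ j = (Fin.last n).castSucc) ↔ n ≤ (j : ℕ) := by
  constructor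
  · rintro (h | h) <;> simp [h]
  · intro h
    have hj : (j : ℕ) < n + 2 := j.isLt
    by_cases h1 : (j : ℕ) = n + 1
    · left; exact Fin.ext (by simp [h1])
    · right; exact Fin.ext (by simp; omega)

/-- An interior index is `< n`. [folklore] -/
theorem lt_of_not_pair {j : Fin (n + 2)} (h : ¬ (j = Fin.last (n + 1) ∨ j = (Fin.last n).castSucc)) : (j : ℕ) < n := by
  rw [pair_iff] at h
  omega

/-- The interior indices `{j // ¬(j = a ∨ j = b)}` are `Fin n` via `Fin.castSucc ∘ Fin.castSucc`. [folklore] -/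
def interiorEquiv (n : ℕ) : Fin n ≃ {j : Fin (n + 2) // ¬ (j = Fin.last (n + 1) ∨ j = (Fin.last n).castSucc)} where
  toFun k := ⟨k.castSucc.castSucc, by rw [pair_iff]; simp⟩
  invFun j := ⟨(j.1 : ℕ), lt_of_not_pair j.2⟩
  left_inv k := by ext; simp
  right_inv j := by
    apply Subtype.ext
    ext
    simp

/-- `interiorEquiv` is `Fin.castSucc ∘ Fin.castSucc` on values. [folklore] -/
theorem val_interiorEquiv (k : Fin n) : ((interiorEquiv n k) : Fin (n + 2)) = k.castSucc.castSucc := rfl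

/-- The pair indices `{j // j = a ∨ j = b}` are `Fin 2` (`0 ↦ a`, `1 ↦ b`). [folklore] -/
def pairEquiv (n : ℕ) : Fin 2 ≃ {j : Fin (n + 2) // j = Fin.last (n + 1) ∨ j = (Fin.last n).castSucc} where
  toFun i := if i = 0 then ⟨Fin.last (n + 1), Or.inl rfl⟩ else ⟨(Fin.last n).castSucc, Or.inr rfl⟩
  invFun j := if (j : Fin (n + 2)) = Fin.last (n + 1) then 0 else 1
  left_inv i := by
    fin_cases i
    · simp
    · simp [last_ne_castSucc_last.symm]
  right_inv j := by
    obtain ⟨j, hj | hj⟩ := j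
    · subst hj; simp
    · subst hj; simp [last_ne_castSucc_last.symm]

/-- Values of `pairEquiv`. [folklore] -/
theorem val_pairEquiv_zero : ((pairEquiv n 0) : Fin (n + 2)) = Fin.last (n + 1) := by simp [pairEquiv]

/-- Values of `pairEquiv`. [folklore] -/
theorem val_pairEquiv_one : ((pairEquiv n 1) : Fin (n + 2)) = (Fin.last n).castSucc := by simp [pairEquiv]

/-! ### §2 The column-replaced identity `X` and the product `A·X` -/

/-- `X`: the identity matrix with columns `a, b` replaced by the corresponding columns of `adj A`. -/
def adjCols (A : Matrix (Fin (n + 2)) (Fin (n + 2)) R) : Matrix (Fin (n + 2)) (Fin (n + 2)) R :=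
  Matrix.of fun i j => if j = Fin.last (n + 1) ∨ j = (Fin.last n).castSucc then A.adjugate i j else (if i = j then 1 else 0)

/-- `A·X` is `A` with columns `a, b` replaced by `det A·e_a`, `det A·e_b` (✓ `Matrix.mul_adjugate`). [folklore] -/
theorem mul_adjCols (A : Matrix (Fin (n + 2)) (Fin (n + 2)) R) :
    A * adjCols A = Matrix.of fun i j =>
      if j = Fin.last (n + 1) ∨ j = (Fin.last n).castSucc then (if i = j then A.det else 0) else A i j := by
  ext i j
  rw [Matrix.mul_apply, Matrix.of_apply]
  by_cases hj : j = Fin.last (n + 1) ∨ j = (Fin.last n).castSucc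
  · simp only [adjCols, Matrix.of_apply, if_pos hj]
    have h := congrFun (congrFun (mul_adjugate A) i) j
    rw [Matrix.mul_apply] at h
    rw [h, Matrix.smul_apply, Matrix.one_apply, smul_eq_mul, mul_ite, mul_one, mul_zero]
  · simp only [adjCols, Matrix.of_apply, if_neg hj, mul_ite, mul_one, mul_zero, Finset.sum_ite_eq', Finset.mem_univ, if_true]

/-- `det X = adj aa · adj bb − adj ab · adj ba` (block-triangular for {a,b} ⊔ interior). [folklore] -/
theorem det_adjCols (A : Matrix (Fin (n + 2)) (Fin (n + 2)) R) :
    (adjCols A).det = A.adjugate (Fin.last (n + 1)) (Fin.last (n + 1)) * A.adjugate (Fin.last n).castSucc (Fin.last n).castSucc -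
      A.adjugate (Fin.last (n + 1)) (Fin.last n).castSucc * A.adjugate (Fin.last n).castSucc (Fin.last (n + 1)) := by
  classical
  rw [twoBlockTriangular_det' (adjCols A) (fun j => j = Fin.last (n + 1) ∨ j = (Fin.last n).castSucc)]
  · -- pair block = the 2×2 adjugate minor; interior block = 1
    have h1 : (toSquareBlockProp (adjCols A) fun j => ¬ (j = Fin.last (n + 1) ∨ j = (Fin.last n).castSucc)) = 1 := by
      ext i j
      rw [toSquareBlockProp_def, Matrix.of_apply]
      simp only [adjCols, Matrix.of_apply, if_neg j.2, Matrix.one_apply, Subtype.ext_iff]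
    rw [h1, det_one, mul_one]
    rw [← det_submatrix_equiv_self (pairEquiv n), det_fin_two]
    simp only [submatrix_apply, toSquareBlockProp_def, Matrix.of_apply, val_pairEquiv_zero, val_pairEquiv_one, adjCols,
      true_or, or_true, if_true]
  · intro i hi j hj
    simp only [adjCols, Matrix.of_apply, if_neg hj]
    rw [if_neg]
    rintro rfl
    exact hj hi

/-- `det (A·X) = det A² · det A[interior]` (block-triangular the other way). [folklore] -/
theorem det_mul_adjCols (A : Matrix (Fin (n + 2)) (Fin (n + 2)) R) :
    (A * adjCols A).det = A.det * A.det * (A.submatrix (Fin.castSucc ∘ Fin.castSucc) (Fin.castSucc ∘ Fin.castSucc)).det := by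
  classical
  rw [mul_adjCols, twoBlockTriangular_det _ (fun j => j = Fin.last (n + 1) ∨ j = (Fin.last n).castSucc)]
  · have hpair : (toSquareBlockProp (Matrix.of fun i j : Fin (n + 2) =>
        if j = Fin.last (n + 1) ∨ j = (Fin.last n).castSucc then (if i = j then A.det else 0) else A i j)
        fun j => j = Fin.last (n + 1) ∨ j = (Fin.last n).castSucc) = A.det • (1 : Matrix _ _ R) := by
      ext i j
      rw [toSquareBlockProp_def, Matrix.of_apply, Matrix.of_apply, if_pos j.2, Matrix.smul_apply, Matrix.one_apply, smul_eq_mul, mul_ite,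
        mul_one, mul_zero]
      simp only [Subtype.ext_iff]
    have hint : (toSquareBlockProp (Matrix.of fun i j : Fin (n + 2) =>
        if j = Fin.last (n + 1) ∨ j = (Fin.last n).castSucc then (if i = j then A.det else 0) else A i j)
        fun j => ¬ (j = Fin.last (n + 1) ∨ j = (Fin.last n).castSucc)).det =
        (A.submatrix (Fin.castSucc ∘ Fin.castSucc) (Fin.castSucc ∘ Fin.castSucc)).det := by
      rw [← det_submatrix_equiv_self (interiorEquiv n)]
      congr 1
      ext i j
      simp only [submatrix_apply, toSquareBlockProp_def, Matrix.of_apply, Function.comp_apply, val_interiorEquiv]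
      exact if_neg (interiorEquiv n j).2
    rw [hpair, hint, det_smul, det_one, mul_one, Fintype.card_subtype]
    have hcard : (Finset.univ.filter fun j : Fin (n + 2) => j = Fin.last (n + 1) ∨ j = (Fin.last n).castSucc).card = 2 := by
      have : (Finset.univ.filter fun j : Fin (n + 2) => j = Fin.last (n + 1) ∨ j = (Fin.last n).castSucc) =
          {Fin.last (n + 1), (Fin.last n).castSucc} := by
        ext j; simp
      rw [this, Finset.card_pair last_ne_castSucc_last]
    rw [hcard, pow_two]
  · intro i hi j hj
    rw [Matrix.of_apply, if_pos hj, if_neg]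
    rintro rfl
    exact hi hj

/-! ### §3 Jacobi's 2 × 2 minor of the adjugate, by generic cancellation -/

/-- Before cancellation: `det A · (adj aa·adj bb − adj ab·adj ba) = det A² · det A[interior]`, in every commutative ring. [folklore] -/
theorem det_mul_adjugate_lastTwo_minor (A : Matrix (Fin (n + 2)) (Fin (n + 2)) R) :
    A.det * (A.adjugate (Fin.last (n + 1)) (Fin.last (n + 1)) * A.adjugate (Fin.last n).castSucc (Fin.last n).castSucc -
      A.adjugate (Fin.last (n + 1)) (Fin.last n).castSucc * A.adjugate (Fin.last n).castSucc (Fin.last (n + 1))) =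
      A.det * (A.det * (A.submatrix (Fin.castSucc ∘ Fin.castSucc) (Fin.castSucc ∘ Fin.castSucc)).det) := by
  rw [← det_adjCols, ← det_mul, det_mul_adjCols, mul_assoc]

/-- ★ **JACOBI (2 × 2 case): `adj A a a · adj A b b − adj A a b · adj A b a = det A · det A[interior]`** (cancellation in the generic matrix ring, then specialisation). -/
theorem adjugate_lastTwo_minor (A : Matrix (Fin (n + 2)) (Fin (n + 2)) R) :
    A.adjugate (Fin.last (n + 1)) (Fin.last (n + 1)) * A.adjugate (Fin.last n).castSucc (Fin.last n).castSucc -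
      A.adjugate (Fin.last (n + 1)) (Fin.last n).castSucc * A.adjugate (Fin.last n).castSucc (Fin.last (n + 1)) =
      A.det * (A.submatrix (Fin.castSucc ∘ Fin.castSucc) (Fin.castSucc ∘ Fin.castSucc)).det := by
  -- the generic matrix
  let A' := mvPolynomialX (Fin (n + 2)) (Fin (n + 2)) ℤ
  have hgen : A'.adjugate (Fin.last (n + 1)) (Fin.last (n + 1)) * A'.adjugate (Fin.last n).castSucc (Fin.last n).castSucc -
      A'.adjugate (Fin.last (n + 1)) (Fin.last n).castSucc * A'.adjugate (Fin.last n).castSucc (Fin.last (n + 1)) =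
      A'.det * (A'.submatrix (Fin.castSucc ∘ Fin.castSucc) (Fin.castSucc ∘ Fin.castSucc)).det :=
    mul_left_cancel₀ (det_mvPolynomialX_ne_zero (Fin (n + 2)) ℤ) (det_mul_adjugate_lastTwo_minor A')
  -- specialise along `aeval A`
  let f := MvPolynomial.aeval (R := ℤ) fun p : Fin (n + 2) × Fin (n + 2) => A p.1 p.2
  have hA : f.mapMatrix A' = A := mvPolynomialX_mapMatrix_aeval ℤ A
  have hadj : ∀ i j, f (A'.adjugate i j) = A.adjugate i j := by
    intro i j
    rw [← hA, ← AlgHom.map_adjugate]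
    rfl
  have hdet : f A'.det = A.det := by rw [AlgHom.map_det, hA]
  have hsub : f (A'.submatrix (Fin.castSucc ∘ Fin.castSucc) (Fin.castSucc ∘ Fin.castSucc)).det =
      (A.submatrix (Fin.castSucc ∘ Fin.castSucc) (Fin.castSucc ∘ Fin.castSucc)).det := by
    rw [AlgHom.map_det, ← hA]
    rfl
  have h := congrArg f hgen
  rw [map_sub, map_mul, map_mul, map_mul, hadj, hadj, hadj, hadj, hdet, hsub] at h
  exact h

/-! ### §4 Desnanot–Jacobi -/

/-- ★★ **DESNANOT–JACOBI (Dodgson condensation), last two rows/columns:** with `a = Fin.last (n+1)`, `b = (Fin.last n).castSucc`,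
`det A · det A[interior] = det A_a^a · det A_b^b − det A_a^b · det A_b^a`, where `A_r^c = A.submatrix r.succAbove c.succAbove` deletes row `r` and column `c`. -/
theorem desnanot_jacobi (A : Matrix (Fin (n + 2)) (Fin (n + 2)) R) :
    A.det * (A.submatrix (Fin.castSucc ∘ Fin.castSucc) (Fin.castSucc ∘ Fin.castSucc)).det =
      (A.submatrix (Fin.last (n + 1)).succAbove (Fin.last (n + 1)).succAbove).det *
          (A.submatrix (Fin.last n).castSucc.succAbove (Fin.last n).castSucc.succAbove).det -
        (A.submatrix (Fin.last (n + 1)).succAbove (Fin.last n).castSucc.succAbove).det *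
          (A.submatrix (Fin.last n).castSucc.succAbove (Fin.last (n + 1)).succAbove).det := by
  rw [← adjugate_lastTwo_minor, adjugate_fin_succ_eq_det_submatrix, adjugate_fin_succ_eq_det_submatrix,
    adjugate_fin_succ_eq_det_submatrix, adjugate_fin_succ_eq_det_submatrix]
  have e1 : ((-1 : R) ^ ((Fin.last (n + 1) : ℕ) + (Fin.last (n + 1) : ℕ))) = 1 :=
    Even.neg_one_pow ⟨(Fin.last (n + 1) : ℕ), rfl⟩
  have e2 : ((-1 : R) ^ (((Fin.last n).castSucc : Fin (n + 2)) + ((Fin.last n).castSucc : Fin (n + 2)) : ℕ)) = 1 :=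
    Even.neg_one_pow ⟨((Fin.last n).castSucc : Fin (n + 2)), rfl⟩
  rw [e1, e2, one_mul, one_mul]
  have e3 : ((-1 : R) ^ (((Fin.last n).castSucc : Fin (n + 2)) + (Fin.last (n + 1) : ℕ) : ℕ)) *
      ((-1 : R) ^ ((Fin.last (n + 1) : ℕ) + ((Fin.last n).castSucc : Fin (n + 2)) : ℕ)) = 1 := by
    rw [← pow_add]
    exact Even.neg_one_pow ⟨((Fin.last n).castSucc : Fin (n + 2)) + (Fin.last (n + 1) : ℕ), by ring⟩
  have hx : ((-1 : R) ^ (((Fin.last n).castSucc : Fin (n + 2)) + (Fin.last (n + 1) : ℕ) : ℕ) *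
        (A.submatrix (Fin.last n).castSucc.succAbove (Fin.last (n + 1)).succAbove).det) *
      ((-1 : R) ^ ((Fin.last (n + 1) : ℕ) + ((Fin.last n).castSucc : Fin (n + 2)) : ℕ) *
        (A.submatrix (Fin.last (n + 1)).succAbove (Fin.last n).castSucc.succAbove).det) =
      (A.submatrix (Fin.last (n + 1)).succAbove (Fin.last n).castSucc.succAbove).det *
        (A.submatrix (Fin.last n).castSucc.succAbove (Fin.last (n + 1)).succAbove).det := by
    calc _ = (((-1 : R) ^ (((Fin.last n).castSucc : Fin (n + 2)) + (Fin.last (n + 1) : ℕ) : ℕ)) *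
          ((-1 : R) ^ ((Fin.last (n + 1) : ℕ) + ((Fin.last n).castSucc : Fin (n + 2)) : ℕ))) *
          ((A.submatrix (Fin.last n).castSucc.succAbove (Fin.last (n + 1)).succAbove).det *
            (A.submatrix (Fin.last (n + 1)).succAbove (Fin.last n).castSucc.succAbove).det) := by ring
      _ = _ := by rw [e3, one_mul, mul_comm]
  rw [hx]

end Summit.ValiantsHypothesis.ValiantsHypothesis.Theorems.TwoProducts.DesnanotJacobi
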